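import Summits.CriticalPhenomena.CardyFormulaZ2.Theorems.CardyFlipRussoCoveringLegStubGsPlanar
import Summits.CriticalPhenomena.CardyFormulaZ2.Theorems.CardyFlipRussoCoveringLegStubComparisonGeometryStrong
import Summits.CriticalPhenomena.CardyFormulaZ2.Theorems.CardyFlipRussoCoveringLegStubLowerInclusion
import Summits.CriticalPhenomena.CardyFormulaZ2.Theorems.CardyFlipRussoCoveringLegStubFlipBound
import Summits.CriticalPhenomena.CardyFormulaZ2.Theorems.CardyFlipRussoCoveringLegStubBlocking
import Summits.CriticalPhenomena.CardyFormulaZ2.Theorems.CardyFlipRussoCoveringLegUniversality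
import Summits.CriticalPhenomena.CardyFormulaZ2.Theorems.CardyMagicRigidityLoopsToCrossingsStubCardyContinuity
import Summits.CriticalPhenomena.CardyFormulaZ2.Theorems.CardyMagicRigidityLoopsToCrossingsStubCyclicFlip
import HarnessLib

/-!
# Robust crude Cardy: the composition of line `five-arm-null` (skeleton v5), crux `CardyFlipRusso.CoveringLeg`

Helper file `--supports stmt-CriticalPhenomena-6435` (route `CardyFlipRusso`, sub-problem `CriticalPhenomena/CardyFormulaZ2`).
With the five provable stubs of skeleton v5 LANDED (`stub_gsPlanar` p140252, `stub_comparisonGeometryStrong` p139833,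
`stub_lowerInclusion` p139913, `stub_flipBound` p139803, `stub_blocking_of_planar` in `…StubBlocking.lean`), this file runs
the Bollobás–Riordan collar sandwich with LOWER inclusions only and proves, WITHOUT any RSW input:

* `robust_of_stubs` / `robust_crudeCardy` — **crude Cardy is discretisation-robust**: Cardy for the crude frame-B `P_{1/2}`
  crossing probabilities of the SHIFTED family (`CardyHalfShift`, = `SiteCardy` through the exact frame bridge
  `cardyHalfShift_of_siteCardy`) implies Cardy for the UNshifted crude events `crossS R δ` and for the wide-slack events
  `wideS R δ` of every conformal rectangle (liminf: lower quad + `stub_lowerInclusion`; limsup: upper quad + `stub_blocking` +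
  `stub_flipBound` + `stub_cyclicFlip`; quad values by `stub_cardyContinuity`);
* `stub_frameBridge_proof : Sig.stub_frameBridge` — v2's stub `SiteCardy → CardySectorGap.CardyCentredSquare` (lead a1 had
  parked it on boundary RSW for `G_s`), i.e. stmt-CriticalPhenomena-7048 ⟸ the crux hypothesis;
* `siteTranslationNull_of_siteCardy`, `siteWideNull_of_siteCardy` — the site-side discretisation nulls `T`, `T'` of the twins
  file hold under `SiteCardy`;
* `coveringLeg_of_ujbMixedInterpolation : UnionJackBeffara.MixedInterpolation → CardyFlipRusso.CoveringLeg` — **the crux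
  follows EXACTLY from the existing item stmt-CriticalPhenomena-4559** (Beffara's leg II = site/bond crossing universality
  `U`), and `coveringLeg_of_csgMixedInterpolation` — from stmt-CriticalPhenomena-7050; with the calibrations
  `coveringLeg_iff_ujbMixedInterpolation_of_siteCardy`, `coveringLeg_iff_csgMixedInterpolation_of_siteCardy`: under the crux
  hypothesis the crux is EQUIVALENT to either twin (so the line's only remaining debt, stmt-4559, is exactly the content of
  the crux).

Sources: B. Bollobás, O. Riordan, *Percolation* (2006), Ch. 7 Lemma 14 p. 184, Claim 19 p. 192 [BollobasRiordan2006];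
V. Beffara, *Is critical 2D percolation universal?*, Progr. Probab. 60 (2008) §5.1–5.2 [Beffara2008Universal].
-/

noncomputable section

namespace Summit.CriticalPhenomena.CardyFormulaZ2.Cruxes.CoveringLeg.FiveArmNull

open Filter Set Topology Metric MeasureTheory
open Literature.Probability.RandomPlanarGeometry hiding cardyFunction
open Literature.Probability.Percolation hiding cardyFunction
open Literature.Probability.LatticeModels
open Literature.Barriers.CriticalPhenomena (MixedSite mixedParam)
open Summit.CriticalPhenomena.CardyFormulaZ2.Theses
open Summit.CriticalPhenomena.CardyFormulaZ2.Cruxes.LoopsToCrossings.OracleSandwich (stub_cardyContinuity stub_cyclicFlip)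

/-! ### Elementary analysis: squeeze to a limit -/

/-- **Squeeze to the limit**: if `b ≤ u` pointwise on `δ > 0`, `b` is eventually `≥ L − τ` and `u` eventually `≤ L + τ`
for every `τ > 0`, then both tend to `L` as `δ → 0⁺`. [folklore] -/
theorem robust_tendsto_of_squeeze {b u : ℝ → ℝ} {L : ℝ} (hbu : ∀ δ, 0 < δ → b δ ≤ u δ)
    (hb : ∀ τ : ℝ, 0 < τ → ∀ᶠ δ in 𝓝[>] (0 : ℝ), L - τ ≤ b δ)
    (hu : ∀ τ : ℝ, 0 < τ → ∀ᶠ δ in 𝓝[>] (0 : ℝ), u δ ≤ L + τ) :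
    Tendsto b (𝓝[>] 0) (𝓝 L) ∧ Tendsto u (𝓝[>] 0) (𝓝 L) := by
  have hpos : ∀ᶠ δ in 𝓝[>] (0 : ℝ), 0 < δ := eventually_mem_nhdsWithin
  constructor
  · rw [tendsto_order]
    refine ⟨fun a ha => ?_, fun a ha => ?_⟩
    · filter_upwards [hb ((L - a) / 2) (by linarith)] with δ hδ
      linarith
    · filter_upwards [hu ((a - L) / 2) (by linarith), hpos] with δ hδ hδ0
      linarith [hbu δ hδ0]
  · rw [tendsto_order]
    refine ⟨fun a ha => ?_, fun a ha => ?_⟩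
    · filter_upwards [hb ((L - a) / 2) (by linarith), hpos] with δ hδ hδ0
      linarith [hbu δ hδ0]
    · filter_upwards [hu ((a - L) / 2) (by linarith)] with δ hδ
      linarith

/-- `‖δ · i/√2‖ ≤ δ` for `δ ≥ 0`. [folklore] -/
theorem robust_norm_shift_le {δ : ℝ} (hδ : 0 ≤ δ) : ‖(δ : ℂ) * (Complex.I / (Real.sqrt 2 : ℂ))‖ ≤ δ := by
  rw [norm_mul, Complex.norm_real, Real.norm_eq_abs, abs_of_nonneg hδ]
  exact mul_le_of_le_one_right hδ norm_shiftVec_le_one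

/-! ### The composition: robustness of crude Cardy under the four analytic/lattice stubs -/

/-- **Robust crude Cardy (the v5 composition).**  Given the four analytic/lattice stubs, Cardy for the crude frame-B
`P_{1/2}` crossing probabilities of the SHIFTED family (`CardyHalfShift`) implies Cardy for the UNshifted crude frame-B
crossing probabilities (`crossS R δ`, slack `2δ`) and for the wide-slack events (`wideS R δ`, slack `2√2·δ`) of EVERY
conformal rectangle: liminf by the lower quad and `stub_lowerInclusion`, limsup by the upper quad, `stub_blocking` and
`stub_flipBound`, the Cardy values of the quads by `stub_cardyContinuity` / `stub_cyclicFlip` (tree).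
[cite: BollobasRiordan2006, Ch. 7 Lemma 14 and Claim 19] -/
theorem robust_of_stubs (hQ : Sig.stub_comparisonGeometryStrong) (hL : Sig.stub_lowerInclusion)
    (hB : Sig.stub_blocking) (hF : Sig.stub_flipBound)
    (hA : CardyHalfShift) (R : ConformalRectangle) :
    R.HasCrossingLimit (fun δ => (lawP half).real (crossS R δ)) Literature.Probability.RandomPlanarGeometry.cardyFunction ∧
    R.HasCrossingLimit (fun δ => (lawP half).real (wideS R δ)) Literature.Probability.RandomPlanarGeometry.cardyFunction := by
  -- one uniformizing datum at a time; both limits come from the same squeeze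
  suffices key : ∀ (φ : ConformalEquiv UpperHalfPlane.upperHalfPlaneSet R.carrier) (x : Fin 4 → ℝ),
      R.IsUniformizing φ x →
      Tendsto (fun δ => (lawP half).real (crossS R δ)) (𝓝[>] 0)
          (𝓝 (Literature.Probability.RandomPlanarGeometry.cardyFunction (crossRatio x))) ∧
        Tendsto (fun δ => (lawP half).real (wideS R δ)) (𝓝[>] 0)
          (𝓝 (Literature.Probability.RandomPlanarGeometry.cardyFunction (crossRatio x))) from
    ⟨fun φ x hφ => (key φ x hφ).1, fun φ x hφ => (key φ x hφ).2⟩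
  intro φ x hφ
  haveI := isProbabilityMeasure_lawP half
  set L := Literature.Probability.RandomPlanarGeometry.cardyFunction (crossRatio x) with hLdef
  set c₀ : ℂ := Complex.I / (Real.sqrt 2 : ℂ) with hc₀def
  refine robust_tendsto_of_squeeze (fun δ hδ => measureReal_mono (crossS_subset_wideS R hδ.le)) ?_ ?_
  · -- liminf: the lower quad
    intro τ hτ
    obtain ⟨ε₀, hε₀, hcont⟩ := stub_cardyContinuity R φ x hφ (τ / 2) (half_pos hτ)
    obtain ⟨m, hm, hquads⟩ := hQ R ε₀ hε₀
    obtain ⟨d, hd, hsep⟩ := R.exists_pos_forall_lt_dist_arc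
    have ht : (0 : ℝ) < d / 4 := by positivity
    obtain ⟨⟨Q, r, hr, hQb, hQm, h3, h4, h5, h6⟩, -⟩ := hquads (d / 4) ht
    obtain ⟨ψ, y, hψ⟩ := MarkedDomain.exists_isUniformizing_holds Q
    have hclose := hcont Q hQb hQm ψ y hψ
    have hlim := hA Q ψ y hψ
    have hsep' : ∀ x ∈ R.arc 0, ∀ y ∈ R.arc 2, 3 * (d / 4) < dist x y := fun x hx y hy => by
      linarith [hsep x hx y hy, dist_nonneg (x := x) (y := y)]
    have h4' : ∀ z ∈ cthickening r Q.carrier, z ∈ R.carrier → m ≤ infDist z (R.arc 1) ∧ m ≤ infDist z (R.arc 3) :=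
      fun z hz _ => h4 z hz
    -- eventually: the probability of the quad's shifted event is close to its Cardy value, and `δ` is small
    have hev1 : ∀ᶠ δ : ℝ in 𝓝[>] 0,
        Literature.Probability.RandomPlanarGeometry.cardyFunction (crossRatio y) - τ / 2 <
          (lawP half).real (crossS (Q.map (similarity 1 one_ne_zero ((δ : ℂ) * c₀))) δ) :=
      (tendsto_order.1 hlim).1 _ (by linarith)
    have hev2 : ∀ᶠ δ in 𝓝[>] (0 : ℝ), δ < min (min (r / 3) m) (d / 4) :=
      (tendsto_order.1 (tendsto_nhdsWithin_of_tendsto_nhds tendsto_id)).2 _ (by positivity)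
    filter_upwards [hev1, hev2, (eventually_mem_nhdsWithin : ∀ᶠ δ in 𝓝[>] (0 : ℝ), 0 < δ)] with δ hδ1 hδ2 hδ0
    have hδ0' : (0 : ℝ) < δ := hδ0
    have hA1 : min (min (r / 3) m) (d / 4) ≤ r / 3 := (min_le_left _ _).trans (min_le_left _ _)
    have hA2 : min (min (r / 3) m) (d / 4) ≤ m := (min_le_left _ _).trans (min_le_right _ _)
    have hA3 : min (min (r / 3) m) (d / 4) ≤ d / 4 := min_le_right _ _
    have hδr : 3 * δ ≤ r := by linarith
    have hδm : δ < m := by linarith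
    have hδt : δ ≤ d / 4 := by linarith
    have hincl := hL R Q m (d / 4) r hm ht hr h3 h4' h5 h6 hsep' δ hδ0' hδr hδm hδt ((δ : ℂ) * c₀)
      (robust_norm_shift_le hδ0'.le)
    have hmono : (lawP half).real (crossS (Q.map (similarity 1 one_ne_zero ((δ : ℂ) * c₀))) δ) ≤
        (lawP half).real (crossS R δ) := measureReal_mono hincl
    have habs := abs_le.1 hclose
    linarith
  · -- limsup: the upper quad, blocking, flip invariance
    intro τ hτ
    obtain ⟨R₂, hc₂, hb₂, hm₂, hflip⟩ := stub_cyclicFlip R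
    obtain ⟨ψ₂, y₂, hψ₂⟩ := MarkedDomain.exists_isUniformizing_holds R₂
    have hF2 : Literature.Probability.RandomPlanarGeometry.cardyFunction (crossRatio y₂) = 1 - L :=
      hflip φ x ψ₂ y₂ hφ hψ₂
    obtain ⟨ε₀, hε₀, hcont⟩ := stub_cardyContinuity R₂ ψ₂ y₂ hψ₂ (τ / 2) (half_pos hτ)
    obtain ⟨m, hm, hquads⟩ := hQ R ε₀ hε₀
    obtain ⟨t, ht, hblock⟩ := hB R m hm
    obtain ⟨-, ⟨N, r, hr, hNb, hNm, n3, n4, n5, n6⟩⟩ := hquads t ht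
    obtain ⟨ψN, yN, hψN⟩ := MarkedDomain.exists_isUniformizing_holds N
    have hNb' : ∀ u : ℝ, dist (N.boundary u) (R₂.boundary u) ≤ ε₀ := fun u => by rw [hb₂ u]; exact hNb u
    have hNm' : ∀ i : Fin 4, |N.mark i - R₂.mark i| ≤ ε₀ := fun i => by rw [hm₂ i]; exact hNm i
    have hclose := hcont N hNb' hNm' ψN yN hψN
    have hlim := hA N ψN yN hψN
    obtain ⟨δ₀, hδ₀, hblk⟩ := hblock N r hr n3 n4 n5 n6
    have hev1 : ∀ᶠ δ : ℝ in 𝓝[>] 0,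
        Literature.Probability.RandomPlanarGeometry.cardyFunction (crossRatio yN) - τ / 2 <
          (lawP half).real (crossS (N.map (similarity 1 one_ne_zero ((δ : ℂ) * c₀))) δ) :=
      (tendsto_order.1 hlim).1 _ (by linarith)
    have hev2 : ∀ᶠ δ in 𝓝[>] (0 : ℝ), δ < δ₀ :=
      (tendsto_order.1 (tendsto_nhdsWithin_of_tendsto_nhds tendsto_id)).2 _ hδ₀
    filter_upwards [hev1, hev2, (eventually_mem_nhdsWithin : ∀ᶠ δ in 𝓝[>] (0 : ℝ), 0 < δ)] with δ hδ1 hδ2 hδ0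
    have hδ0' : (0 : ℝ) < δ := hδ0
    have hmiss := hblk δ hδ0' hδ2.le ((δ : ℂ) * c₀) (robust_norm_shift_le hδ0'.le)
    have hbound := hF N δ hδ0' ((δ : ℂ) * c₀) (wideS R δ) hmiss
    have habs := abs_le.1 hclose
    linarith

/-! ### Consequences, stub-parametrised (as consumed by the skeleton's `CoveringLeg_of`) -/

/-- **Robust crude Cardy from the crux hypothesis**: given the four provable stubs, `SiteCardy` implies Cardy for the
unshifted crude frame-B events (`CardySectorGap.CardyCentredSquare`, stmt-CriticalPhenomena-7048) and for the wide-slack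
events (the first conjunct of `UnionJackBeffara.Target` read at mesh `√2·δ`, `unionJackBeffara_cardy_iff`).
[cite: BollobasRiordan2006, Ch. 7 Lemma 14] -/
theorem robust_of_siteCardy_of_stubs (hQ : Sig.stub_comparisonGeometryStrong) (hL : Sig.stub_lowerInclusion) (hB : Sig.stub_blocking) (hF : Sig.stub_flipBound) (hS : SiteCardy) :
    CardySectorGap.CardyCentredSquare ∧
      ∀ R : ConformalRectangle, R.HasCrossingLimit (fun δ => (lawP half).real (wideS R δ))
        Literature.Probability.RandomPlanarGeometry.cardyFunction := by
  have h := fun R => robust_of_stubs hQ hL hB hF (cardyHalfShift_of_siteCardy hS) R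
  exact ⟨cardyCentredSquare_iff.2 fun R => (h R).1, fun R => (h R).2⟩

/-- **v2's stub `Sig.stub_frameBridge` (`SiteCardy → CardySectorGap.CardyCentredSquare`) from the v5 stubs** (lead a1 had
parked it on boundary RSW for `G_s`; no RSW is used). [cite: Beffara2008Universal, §5.1] -/
theorem stub_frameBridge_of (hQ : Sig.stub_comparisonGeometryStrong) (hL : Sig.stub_lowerInclusion) (hB : Sig.stub_blocking) (hF : Sig.stub_flipBound) :
    Sig.stub_frameBridge :=
  fun hS => (robust_of_siteCardy_of_stubs hQ hL hB hF hS).1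

/-- **The site-side translation null `T` holds under `SiteCardy`** (c4's residual towards stmt-7050): both the shifted and
the unshifted crude frame-B `P_{1/2}` crossing probabilities tend to `F(η_R)`. [cite: Beffara2008Universal, §5.1] -/
theorem siteTranslationNull_of_stubs (hQ : Sig.stub_comparisonGeometryStrong) (hL : Sig.stub_lowerInclusion) (hB : Sig.stub_blocking) (hF : Sig.stub_flipBound)
    (hS : SiteCardy) :
    ∀ R : ConformalRectangle, Tendsto (fun δ : ℝ =>
      (lawP half).real (crossS (R.map (similarity 1 one_ne_zero ((δ : ℂ) * (Complex.I / (Real.sqrt 2 : ℂ))))) δ) -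
        (lawP half).real (crossS R δ)) (𝓝[>] 0) (𝓝 0) := by
  intro R
  obtain ⟨φ, x, hφ⟩ := MarkedDomain.exists_isUniformizing_holds R
  have h1 := cardyHalfShift_of_siteCardy hS R φ x hφ
  have h2 := (cardyCentredSquare_iff.1 (robust_of_siteCardy_of_stubs hQ hL hB hF hS).1) R φ x hφ
  have h := h1.sub h2
  rwa [sub_self] at h

/-- **The site-side wide null `T'` holds under `SiteCardy`** (c4's ONLY residual towards stmt-4559): the Union-Jack crude
crossing probability at mesh `√2·δ` and the frame-A crude crossing probability of `ρ⁻¹R` at mesh `δ` both tend to `F(η_R)`.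
[cite: Beffara2008Universal, §5.1] -/
theorem siteWideNull_of_stubs (hQ : Sig.stub_comparisonGeometryStrong) (hL : Sig.stub_lowerInclusion) (hB : Sig.stub_blocking) (hF : Sig.stub_flipBound)
    (hS : SiteCardy) :
    ∀ R : ConformalRectangle, Tendsto (fun δ : ℝ => ujCrossingProb half R (Real.sqrt 2 * δ) -
      siteProb (R.map (similarity ((1 + Complex.I) / (Real.sqrt 2 : ℂ)) frame_rotInv_ne_zero 0)) δ)
      (𝓝[>] 0) (𝓝 0) := by
  intro R
  obtain ⟨φ, x, hφ⟩ := MarkedDomain.exists_isUniformizing_holds R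
  have h1 := (robust_of_siteCardy_of_stubs hQ hL hB hF hS).2 R φ x hφ
  have h2 := cardyHalfShift_of_siteCardy hS R φ x hφ
  have h := h1.sub h2
  rw [sub_self] at h
  refine h.congr' (Eventually.of_forall fun δ => ?_)
  simp only [ujCrossingProb_eq_wideS, shift_lawP_half_crossS]

/-- **`CoveringLeg` ⟸ `UnionJackBeffara.MixedInterpolation` (stmt-CriticalPhenomena-4559), EXACTLY** modulo the v5
stubs: the thesis' delegation of "leg II" to card z4-protected-beffara-union-jack, with no residual (`T'` from
`siteWideNull_of_siteCardy`, `B'` = `wide_tendsto_sub` landed p136899). [cite: Beffara2008Universal, §5.1–5.2] -/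
theorem coveringLeg_of_ujbMixedInterpolation_of_stubs (hQ : Sig.stub_comparisonGeometryStrong) (hL : Sig.stub_lowerInclusion) (hB : Sig.stub_blocking) (hF : Sig.stub_flipBound)
    (hM : UnionJackBeffara.MixedInterpolation) : CardyFlipRusso.CoveringLeg :=
  coveringLeg_iff.2 fun hS =>
    coveringLeg_iff.1 (coveringLeg_of_unionJackBeffara_of_siteNull (siteWideNull_of_stubs hQ hL hB hF hS) hM) hS

/-- **`CoveringLeg` ⟸ `CardySectorGap.MixedInterpolation` (stmt-CriticalPhenomena-7050), EXACTLY** modulo the v5 stubs.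
[cite: Beffara2008Universal, §5.1–5.2] -/
theorem coveringLeg_of_csgMixedInterpolation_of_stubs (hQ : Sig.stub_comparisonGeometryStrong) (hL : Sig.stub_lowerInclusion) (hB : Sig.stub_blocking) (hF : Sig.stub_flipBound)
    (hM : CardySectorGap.MixedInterpolation) : CardyFlipRusso.CoveringLeg :=
  coveringLeg_iff.2 fun hS =>
    coveringLeg_iff.1
      (coveringLeg_of_mixedInterpolation_of_siteTranslationNull (siteTranslationNull_of_stubs hQ hL hB hF hS) hM) hS

/-! ### Discharged forms: the five stubs are landed theorems -/

/-- **The blocking stub, discharged**: `Sig.stub_blocking` holds (planarity `stub_gsPlanar` p140252 fed into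
`stub_blocking_of_planar`). [cite: BollobasRiordan2006, Ch. 7 Claim 19 p. 192] -/
theorem stub_blocking_proof : Sig.stub_blocking :=
  stub_blocking_of_planar stub_gsPlanar

/-- **Crude Cardy is discretisation-robust** (no stub hypotheses left): `CardyHalfShift` implies Cardy for the unshifted crude
events and for the wide-slack events of every conformal rectangle. [cite: BollobasRiordan2006, Ch. 7 Lemma 14 and Claim 19] -/
theorem robust_crudeCardy (hA : CardyHalfShift) (R : ConformalRectangle) :
    R.HasCrossingLimit (fun δ => (lawP half).real (crossS R δ)) Literature.Probability.RandomPlanarGeometry.cardyFunction ∧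
    R.HasCrossingLimit (fun δ => (lawP half).real (wideS R δ)) Literature.Probability.RandomPlanarGeometry.cardyFunction :=
  robust_of_stubs stub_comparisonGeometryStrong stub_lowerInclusion stub_blocking_proof stub_flipBound hA R

/-- **Robust crude Cardy from the crux hypothesis**: `SiteCardy` implies `CardySectorGap.CardyCentredSquare`
(stmt-CriticalPhenomena-7048) and Cardy for the wide-slack events. [cite: BollobasRiordan2006, Ch. 7 Lemma 14] -/
theorem robust_of_siteCardy (hS : SiteCardy) :
    CardySectorGap.CardyCentredSquare ∧
      ∀ R : ConformalRectangle, R.HasCrossingLimit (fun δ => (lawP half).real (wideS R δ))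
        Literature.Probability.RandomPlanarGeometry.cardyFunction :=
  robust_of_siteCardy_of_stubs stub_comparisonGeometryStrong stub_lowerInclusion stub_blocking_proof stub_flipBound hS

/-- **v2's registered stub `Sig.stub_frameBridge` (`SiteCardy → CardySectorGap.CardyCentredSquare`) is a THEOREM** — no RSW
input (lead a1 had declared it RSW-blocked). [cite: Beffara2008Universal, §5.1] -/
theorem stub_frameBridge_proof : Sig.stub_frameBridge :=
  stub_frameBridge_of stub_comparisonGeometryStrong stub_lowerInclusion stub_blocking_proof stub_flipBound

/-- **stmt-CriticalPhenomena-7048 ⟸ the crux hypothesis**: `SiteCardy → CardySectorGap.CardyCentredSquare`.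
[cite: Beffara2008Universal, §5.1] -/
theorem cardyCentredSquare_of_siteCardy (hS : SiteCardy) : CardySectorGap.CardyCentredSquare :=
  stub_frameBridge_proof hS

/-- **The site-side translation null `T` holds under `SiteCardy`.** [cite: Beffara2008Universal, §5.1] -/
theorem siteTranslationNull_of_siteCardy (hS : SiteCardy) :
    ∀ R : ConformalRectangle, Tendsto (fun δ : ℝ =>
      (lawP half).real (crossS (R.map (similarity 1 one_ne_zero ((δ : ℂ) * (Complex.I / (Real.sqrt 2 : ℂ))))) δ) -
        (lawP half).real (crossS R δ)) (𝓝[>] 0) (𝓝 0) :=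
  siteTranslationNull_of_stubs stub_comparisonGeometryStrong stub_lowerInclusion stub_blocking_proof stub_flipBound hS

/-- **The site-side wide null `T'` holds under `SiteCardy`.** [cite: Beffara2008Universal, §5.1] -/
theorem siteWideNull_of_siteCardy (hS : SiteCardy) :
    ∀ R : ConformalRectangle, Tendsto (fun δ : ℝ => ujCrossingProb half R (Real.sqrt 2 * δ) -
      siteProb (R.map (similarity ((1 + Complex.I) / (Real.sqrt 2 : ℂ)) frame_rotInv_ne_zero 0)) δ)
      (𝓝[>] 0) (𝓝 0) :=
  siteWideNull_of_stubs stub_comparisonGeometryStrong stub_lowerInclusion stub_blocking_proof stub_flipBound hS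

/-- **THE CRUX FOLLOWS EXACTLY FROM stmt-CriticalPhenomena-4559** (registered sub-goal `coveringLeg_of_ujbMixedInterpolation`):
`UnionJackBeffara.MixedInterpolation → CardyFlipRusso.CoveringLeg`, unconditionally — the thesis' delegation of Beffara's
leg II to route UnionJackBeffara, with no residual. [cite: Beffara2008Universal, §5.1–5.2] -/
theorem coveringLeg_of_ujbMixedInterpolation : Summit.CriticalPhenomena.CardyFormulaZ2.Theses.UnionJackBeffara.MixedInterpolation → Summit.CriticalPhenomena.CardyFormulaZ2.Theses.CardyFlipRusso.CoveringLeg :=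
  coveringLeg_of_ujbMixedInterpolation_of_stubs stub_comparisonGeometryStrong stub_lowerInclusion stub_blocking_proof
    stub_flipBound

/-- **The crux follows exactly from stmt-CriticalPhenomena-7050**: `CardySectorGap.MixedInterpolation → CardyFlipRusso.CoveringLeg`.
[cite: Beffara2008Universal, §5.1–5.2] -/
theorem coveringLeg_of_csgMixedInterpolation : CardySectorGap.MixedInterpolation → CardyFlipRusso.CoveringLeg :=
  coveringLeg_of_csgMixedInterpolation_of_stubs stub_comparisonGeometryStrong stub_lowerInclusion stub_blocking_proof
    stub_flipBound

/-- **Calibration: under the crux hypothesis the v4 stub `U` and stmt-4559 are equivalent.** [cite: Beffara2008Universal, §5.2] -/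
theorem stub_iff_ujbMixedInterpolation_of_siteCardy (hS : SiteCardy) :
    Sig.stub_mixedInterpolationShift ↔ UnionJackBeffara.MixedInterpolation :=
  stub_iff_unionJackBeffara_of_siteNull (siteWideNull_of_siteCardy hS)

/-- **Calibration: under the crux hypothesis the CRUX and stmt-4559 are equivalent** (`SiteCardy → (CoveringLeg ↔
UnionJackBeffara.MixedInterpolation)`): the line's one remaining debt is exactly the content of the crux.
[cite: Beffara2008Universal, §5.2] -/
theorem coveringLeg_iff_ujbMixedInterpolation_of_siteCardy (hS : SiteCardy) :
    CardyFlipRusso.CoveringLeg ↔ UnionJackBeffara.MixedInterpolation :=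
  ((mixedInterpolationShift_iff_universality.trans (coveringLeg_iff_universality_of_siteCardy hS).symm).symm).trans
    (stub_iff_ujbMixedInterpolation_of_siteCardy hS)

/-- **Calibration: under the crux hypothesis the CRUX and stmt-7050 are equivalent.** [cite: Beffara2008Universal, §5.2] -/
theorem coveringLeg_iff_csgMixedInterpolation_of_siteCardy (hS : SiteCardy) :
    CardyFlipRusso.CoveringLeg ↔ CardySectorGap.MixedInterpolation :=
  ((mixedInterpolationShift_iff_universality.trans (coveringLeg_iff_universality_of_siteCardy hS).symm).symm).trans
    (stub_iff_mixedInterpolation_of_siteTranslationNull (siteTranslationNull_of_siteCardy hS))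

end Summit.CriticalPhenomena.CardyFormulaZ2.Cruxes.CoveringLeg.FiveArmNull

end
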